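import Summits.QuantumFields.BalabanUV.T4Continuum.Spine.NE1p.DressedSmallFieldOuterLabelsWitnessLive
import Summits.QuantumFields.BalabanUV.T4Continuum.Spine.NE1p.DressedSmallFieldInnerLabelsWitnessMu

/-!
# T⁴ programme, spine estimate NE1′ (node O3b/H2) — WITNESS, PART 2 «THE SOURCE-PENCIL OUTER-LABEL END FIRES ON W52's DATUM, LINK-FREE ON
# THE TORUS»: this lineage's torus face `DressedSmallFieldLinkMu.muPart_locE_le_of_coresAt_pencil_outerLabels_torus` (the owner's N0x
# PART 2 outer-label μ-END with S40.1's (2.27)-link `link_of_ineq227'` INSIDE and pv22's letters located) APPLIED ONCE BY NAME — a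
# DECIDED applier — on W52's outer-label datum (`termsO` ∕ `GO` ∕ `actO`: ALL admissible outer labels `⟨W′, ⟨F, p⟩⟩` of the footprint,
# two decided inner configurations per member, the cube outside `Z′₀` paid by the large-field letter `vO`) read along the SOURCE pencil
# `s ↦ 0 + s • liveTable`; at every REAL source `0 < t ≤ 2` the μ-part is NOT zero

Cell `pub-balaban`, sub-cell `t4`, BINDER-OWNERS row NE1′; crew seat `b2b-balaban-t4-ne1p-formalise-leaf-07` (LEAF PROVER 07, generation
20); crew W-row **W99 ∕ DAG N29zzzzzn, PART 2 of 2** (PART 1 = `DressedSmallFieldInnerLabelsWitnessMu` p244597, the inner-label index on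
W50's datum; INTENT `HOME/CLAIMS.log` l.24832 + PART 2 STAGED l.24920, BOOKED typer gen 9 **R-T154** l.25118 (cap 260); cross-read **X244**
(one X for the node); v1 p244709 BOUNCED `dedup.landed` ×1 — `hrate_Omu` ≡ PART 1's `hrate_Imu`, landed meanwhile — v1.1 IMPORTS PART 1 and
REUSES `hrate_Imu` BY NAME, as the gate's lint prescribes).  ADDITIVE — imports W52 PART 2 `Spine/NE1p/DressedSmallFieldOuterLabelsWitnessLive`
(leaf-09 g12; → W52 PART 1 → the owner's N0v `DressedSmallFieldOuterCount`, W50 PART 1, W45 → W41 → W35 → W33 → W24, row NE5's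
`Support/B13HistWitness`) and PART 1 `Spine/NE1p/DressedSmallFieldInnerLabelsWitnessMu` (→ this seat's S-row S66 `DressedSmallFieldLinkMu` → the
owner's N0x PART 2 `DressedSmallFieldLabelCountsMu`, S40.1; → W50 PART 2) ONLY; THEOREMS ONLY (0 `def`, 0 `def … : Prop`, 0 cite, 0 sorry,
0 `attribute`; one closing `example`); nothing of W52 ∕ W50 ∕ PART 1 ∕ N0x ∕ N0v ∕ S40 ∕ W45 ∕ W41 ∕ W35 ∕ W33 ∕ W24 ∕ pv22 is restated — `termsO`,
`GO`, `GO_apply`, `actO`, `cO`, `majO`, `majO_pos`, `vO`, `vO_pos`, `nO`, `nO_nonneg`, `hmember_O`, `hRR_O`, `hadm_O`, `actO_real_sub_zero`,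
`sum_cO_X₀_pos`, `norm_actO_X₀_lt_one` (W52), `RI` (W50), `hrate_Imu` (PART 1), `δF`∕`κF`∕`α₆F`∕`α₆F_pos`∕`hκ_F`∕`h229_F` (W45), `letterMass_coreW`
∕ `cM` ∕ `hsmall_mu` (W35),
`N₁_coreW` ∕ `ctr0` ∕ `hroom0` ∕ `Acst` ∕ `liveTable` ∕ `integral_incr_pos` (W33), `budget_half` (W41), `hrate_torus` ∕ `exp_locE_cube` ∕ `X₀`
(W24), `torus_consts` (N0o), `K₀_four` (S24) are used BY NAME.

WHY.  W52 fired the owner's N0v outer-label END (resummation steps THREE and FOUR, [Balaban1988RGII] p. 19 (2.35)–(2.37) KIND) for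
the ATTACHED part with the link SUPPLIED from S40.1's `link_torus'`.  S66 §4 is the owner's SOURCE-pencil twin (N0x PART 2
`muPart_locE_le_of_coresAt_pencil_outerLabels`: «μ enters (B3) through the amplitude ALONE») on pv22's torus with the link INSIDE and
NO geometry hypothesis; this file is its decided applier — with PART 1, BOTH label indices of S66 now fire on a datum:
* §1 the binders of the torus face MET on W52's datum, LOCATED: **`hAmp_Omu`** (amplitude at the radius `‖0‖ + μ₁‖liveTable‖`, `μ₁ ≤ 2`,
  constant `A := Acst∕2`, W41's `budget_half`; W52's majorant `majO l = vO^{#W′}·Π nO` IS the face's product), `hmember_Omu` ∕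
  `hRR_Omu` ∕ `hadm_Omu` (W52's clauses re-lettered by `torus_consts` — `κ₀ = 64·log 162`, `c₁ = 64`; the located step rate is PART 1's
  `hrate_Imu` BY NAME); the located
  clauses `64 log 162 + 1 ≤ δF·κF`, `e·K₀(64,8)·64·α₆F ≤ 1`, `(A∕2)·e^{5·0+1}·K₀(64,8)·9·64 ≤ 1` are three-line `have`s inside §2 from
  W45's `hκ_F`∕`h229_F` and W35's `hsmall_mu` (the crew's landed one-liners state them in other cones — not imported, not re-declared);
* §2 **`outerMuEnd_fires`** — the torus face ONCE BY NAME (`h₀ := 0`, `v := liveTable`, `J := fun _ => univ`, `n := nO`, `vW := vO`,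
  `hlink` GONE — it is inside the face), for `0 < μ₀ < μ₁ ≤ 2`, `‖μ‖ ≤ μ₀`; closed form **`outerMuEnd_fires_closed`**:
  `≤ (K₀(64,8)∕2)·μ₀∕(μ₁ − μ₀)`;
* §3 GENUINE: **`actO_mu_live`** (at every REAL source `0 < t` the increment is `(Σ_l cO l)·∫ incr (t·r) ≠ 0` — W52's `sum_cO_X₀_pos`,
  W33's `integral_incr_pos`) and **`outerMuEnd_live`** (`0 < t ≤ 2`; W24's `exp_locE_cube`, W52's `norm_actO_X₀_lt_one`); the
  closing `example` recovers W52 PART 2's `actO_live` as the `t = 1` instance.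

WORDING OF RECORD: W52's (typer R-T127 ∕ R-T129) — «(B3-amp) MET because the weights are CHOSEN as N0v's majorant — UNPRINTED for
Bałaban's cores (G-ne9p2-5); the member budget `hmember` is MET WITH EQUALITY by two decided configurations per member ((2.36) KIND,
TYPE only); the (2.27)∘(2.37) link is S40.1's theorem on pv22's CONSTRUCTED torus; `vO`, `RI`, `A∕4` are OUR numerals» — now for the
source pencil at `A∕2`; `μ₀`, `μ₁` symbolic with `μ₁ ≤ 2` (NE5's class radius), nothing about print's μ-window (w6); the μ-extension is
UNPRINTED (GAPS-T4 C-t4r2-340 (n1)∕(n2)).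

HONEST FRAMING.  A DECIDED TOY ([folklore]; 0 sorry; 0 citations; no `def`).  The cores are THEOREM-backed instances of the cell's typed
FORMAT of (2.14) over row NE5's TOY frame — NOT Bałaban's (2.14) terms; (B1b) NOT claimed; (B3-amp) MET by CHOSEN weights — UNPRINTED
for Bałaban's cores (G-ne9p2-5); `RI = 2κ₀+3`, `vO`, `nO`, `A∕2` are OUR numerals over pv22's located letters; print's `4`∕`5`∕`17`,
`e^{−(κ₁−1)}` and the shapes of (2.27)∕(2.35)–(2.37) ([Balaban1988RGII] = CMP 116 (1988) pp. 18–20) are N0v's DISPLAYED print-shape,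
TYPE only — no numeral of print is asserted as a fact about Bałaban's densities; 0 binders instantiated on Bałaban's densities; no wall
item; the NE1′ wall wording of record v1.8 (T4-DAG v48–v53) — words, not kind — does NOT move; R-t4r2-Q2 NOT met thereby; NE1′ ⇐ the
named binders — NOT proved, NOT printed; spine PROVED 0∕9; count 9 unchanged.  ABSOLUTE RULE honoured: nothing internally minted is
cited; printed loci TYPE∕CONTEXT only.  Rung (B)+1 on ONE finite four-torus — NOT infinite volume, NOT a mass gap, NOT OS on ℝ⁴, NOT
Clay.  HONEST DEPENDENCY: continuum YM on T⁴ ⇐ BetaPertH ∧ nine spine estimates (0/9 proved); BetaPertH ⇐ (D1) ∧ (D4) ∧ CAP+tail;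
G-an2-4 gates asym, D1 and NE2/3/4.
-/

noncomputable section

namespace Summit.QuantumFields.BalabanUV.T4Continuum.NE1p.DressedSmallFieldOuterLabelsWitness

open Set Metric MeasureTheory Complex
open scoped BigOperators
open Literature.MathematicalPhysics.QuantumFieldTheory.Balaban1983to89
open Literature.MathematicalPhysics.QuantumFieldTheory.Balaban1983to89.B12TreeDecay (K₀ K₀_pos)
open Literature.MathematicalPhysics.QuantumFieldTheory.Balaban1983to89.B13Resummation (locE)
open Literature.MathematicalPhysics.QuantumFieldTheory.Balaban1983to89.B13FamilySum (coveringFamilies)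
open Literature.MathematicalPhysics.QuantumFieldTheory.Balaban1983to89.TreeLengthTorus (TPt TDom tsys torusTreeLen)
open Literature.MathematicalPhysics.QuantumFieldTheory.Balaban1983to89.TreeLengthTorusGeometry (tgeometry TTouch)
open Summit.QuantumFields.BalabanUV.T4Continuum.B13HistMeasurable (B13HistM)
open Summit.QuantumFields.BalabanUV.T4Continuum.B13HistWitness (toyFrame)
open Summit.QuantumFields.BalabanUV.T4Continuum.NE1p.DressedSmallFieldTorusWitness (X₀ X₀_val hrate_torus exp_locE_cube)
open Summit.QuantumFields.BalabanUV.T4Continuum.NE1p.DressedSmallFieldGeometry (torus_consts)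
open Summit.QuantumFields.BalabanUV.T4Continuum.NE1p.DressedSmallFieldGeometryFaces (K₀_four)
open Summit.QuantumFields.BalabanUV.T4Continuum.NE1p.DressedSmallFieldCoresWitness (E1 liveTable norm_liveTable_le coreW N₁_coreW ctr0
  hroom0 Acst Acst_pos incr integral_incr_pos)
open Summit.QuantumFields.BalabanUV.T4Continuum.NE1p.DressedSmallFieldCoresMassWitness (letterMass_coreW cM hsmall_mu)
open Summit.QuantumFields.BalabanUV.T4Continuum.NE1p.DressedSmallFieldDepCoresWitness (budget_half)
open Summit.QuantumFields.BalabanUV.T4Continuum.NE1p.DressedSmallFieldFamiliesWitness (δF κF α₆F α₆F_pos hκ_F h229_F)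
open Summit.QuantumFields.BalabanUV.T4Continuum.NE1p.DressedSmallFieldInnerLabelsWitness (RI)
open Summit.QuantumFields.BalabanUV.T4Continuum.NE1p.DressedSmallFieldLinkMu (muPart_locE_le_of_coresAt_pencil_outerLabels_torus)

section Torus
variable (N : ℕ) [NeZero N] (r : ℝ) (hr : 0 ≤ r)

/-! ## §1 The source-pencil amplitude clause at `A := A∕2` and the located clauses of the link-free torus face -/

/-- **`hAmp` ALONG THE SOURCE PENCIL** (`h₀ = 0`, `v = liveTable`, `‖s‖ < μ₁ ≤ 2`, constant `A := Acst∕2`) [decided toy], in the LITERAL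
binder shape of the link-free torus face `muPart_locE_le_of_coresAt_pencil_outerLabels_torus` at NE5's toy letters `(mq, bq, N₀) =
(1, 0, 1)`: `majO(l)·|cM r∕2|·√(2π)·e^{r·μ₁‖liveTable‖} ≤ (A∕2)·majO(l)` (W35 `letterMass_coreW`, W33 `N₁_coreW`, W41 `budget_half`
with `u = μ₁‖liveTable‖ ≤ 2`); the majorant is W52's `vO^{#W′}·Π nO`. [folklore] -/
theorem hAmp_Omu {μ₁ : ℝ} (hμ₁ : μ₁ ≤ 2) (k : ℕ) :
    ∀ Z : (tsys 4 N).Dom, Z.1 ⊆ (X₀ N).1 → ∀ l ∈ termsO N Z,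
      (GO N r hr k l k).lam.real univ *
          ((GO N r hr k l k).wB * (fun (_ : ℕ) (_ : OLabel N) (_ : ℕ) => (1 : ℝ)) k l k *
            Real.exp ((fun (_ : ℕ) (_ : OLabel N) (_ : ℕ) => (0 : ℝ)) k l k)) *
          (Real.pi / ((fun (_ : ℕ) (_ : OLabel N) (_ : ℕ) => (1 : ℝ)) k l k / 2)) ^ (Module.finrank ℝ E1 / 2 : ℝ) *
        Real.exp ((GO N r hr k l k).N₁ * (‖(0 : B13HistM toyFrame)‖ + μ₁ * ‖liveTable‖)) ≤
      Acst / 2 * (vO N ^ l.1.card * ∏ x ∈ l.2.1.attach, nO N x.1 (l.2.2 x.1 x.2)) := by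
  intro Z _ l _
  simp only [GO_apply]
  rw [letterMass_coreW, N₁_coreW, norm_zero, zero_add]
  have hp : 0 ≤ majO N l := (majO_pos N l).le
  have hT : μ₁ * ‖liveTable‖ ≤ 2 := (mul_le_mul hμ₁ norm_liveTable_le (norm_nonneg _) (by norm_num)).trans (by norm_num)
  have hb := budget_half r hr hT
  show |cM r / 2 * majO N l| * Real.sqrt (2 * Real.pi) * Real.exp (r * (μ₁ * ‖liveTable‖)) ≤ Acst / 2 * majO N l
  rw [abs_mul, abs_of_nonneg hp]
  calc |cM r / 2| * majO N l * Real.sqrt (2 * Real.pi) * Real.exp (r * (μ₁ * ‖liveTable‖))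
      = majO N l * (|cM r / 2| * Real.sqrt (2 * Real.pi) * Real.exp (r * (μ₁ * ‖liveTable‖))) := by ring
    _ ≤ majO N l * (Acst / 2) := mul_le_mul_of_nonneg_left hb hp
    _ = Acst / 2 * majO N l := by ring

/-- W52's member budget `hmember_O` in the torus face's spelling (`(tsys 4 N).dj Z′` IS `torusTreeLen Z′.1`). [arith] -/
theorem hmember_Omu : ∀ Z' : (tsys 4 N).Dom,
    ∑ b ∈ (fun _ : (tsys 4 N).Dom => (Finset.univ : Finset Bool)) Z', nO N Z' b ≤
      α₆F * Real.exp (-(δF * κF * torusTreeLen Z'.1)) * Real.exp (-(RI N * (torusTreeLen Z'.1 + 5))) :=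
  hmember_O N

/-- The located rate bookkeeping `hRR` of the torus face: `2κ₀ + 2 ≤ RI − 64·(vO·e^{RI·5})` (W52's `hRR_O` at `c₁ = 64`). [arith] -/
theorem hRR_Omu : 2 * (tgeometry 4 N).κ₀ + 2 ≤ RI N - 64 * (vO N * Real.exp (RI N * 5)) := by
  have h := hRR_O N; rw [(torus_consts N).2.2] at h; exact h

/-- W52's admissibility `hadm_O` in the torus face's footprint spelling (`(tgeometry 4 N).cubes Z` IS `Z.1`). [folklore] -/
theorem hadm_Omu : ∀ Z : (tsys 4 N).Dom, ∀ l ∈ termsO N Z, l.1 ⊆ Z.1 ∧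
    l.2.1 ∈ coveringFamilies Finset.univ (fun Y : (tsys 4 N).Dom => Y.1) (Z.1 \ l.1) ∧
      ∀ Z' (h : Z' ∈ l.2.1), l.2.2 Z' h ∈ (fun _ : (tsys 4 N).Dom => (Finset.univ : Finset Bool)) Z' :=
  hadm_O N

/-! ## §2 THE μ-TWIN FIRES: the LINK-FREE torus face of N0x P2's outer-label μ-END applied ONCE BY NAME (a decided applier) -/

open Classical in
/-- **`muPart_locE_le_of_coresAt_pencil_outerLabels_torus` FIRES ON W52's DATUM** [decided toy]: the SAME activity `actO` (all admissible
outer labels of the footprint, label-indexed cores `GO`) read along the SOURCE pencil `s ↦ 0 + s • liveTable` (`h₀ := 0`, `v := liveTable`,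
`‖s‖ < μ₁ ≤ 2`), `hAmp_Omu` at `A := Acst∕2`, the located clauses (inline `hκ`∕`h229`∕`hsmall`) ∕ PART 1's `hrate_Imu` ∕ `hRR_Omu`, the inner
datum `J := fun _ => univ`, `n := nO`, `hmember_Omu`, `vW := vO`, W52's `hadm_O`, W33's `ctr0`∕`hroom0`, NE5's toy letters INLINE; NO link
binder, NO geometry hypothesis (the torus face carries S40.1's (2.27)-link `link_of_ineq227'` inside); for `0 < μ₀ < μ₁`, `‖μ‖ ≤ μ₀`.
Conclusion LITERAL, in the crew's torus currency. [folklore] -/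
theorem outerMuEnd_fires {μ₁ μ₀ : ℝ} {μ : ℂ} (hμ₁ : μ₁ ≤ 2) (h0 : 0 < μ₀) (h01 : μ₀ < μ₁) (hμ : ‖μ‖ ≤ μ₀) (k : ℕ) :
    ‖locE (TTouch (d := 4) (N := N)) (fun Z : (tsys 4 N).Dom => Z.1) (actO N r hr k μ) (X₀ N).1 -
        locE (TTouch (d := 4) (N := N)) (fun Z : (tsys 4 N).Dom => Z.1) (actO N r hr k 0) (X₀ N).1‖ ≤
      Real.exp 1 * 9 * 64 * K₀ 64 8 ^ 2 * (Acst / 2) * Real.exp (-(0 * torusTreeLen (X₀ N).1)) * (μ₀ / (μ₁ - μ₀)) := by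
  -- the three LOCATED clauses of the torus face on this datum, in three lines from W45's `hκ_F` ∕ `h229_F` and W35's `hsmall_mu`
  -- (stated verbatim by landed one-liners in other cones — not imported, not re-declared)
  have hκ : 64 * Real.log 162 + 1 ≤ δF * κF := by have h := hκ_F N; rw [(torus_consts N).2.1] at h; exact h
  have h229 : Real.exp 1 * K₀ 64 8 * 64 * α₆F ≤ 1 := by have h := h229_F N; rw [(torus_consts N).2.2, K₀_four] at h; exact h
  have hsmall : Acst / 2 * Real.exp (5 * 0 + 1) * K₀ 64 8 * 9 * 64 ≤ 1 := by
    have h := hsmall_mu N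
    rw [(torus_consts N).1, (torus_consts N).2.2, K₀_four] at h
    calc Acst / 2 * Real.exp (5 * 0 + 1) * K₀ 64 8 * 9 * 64 = (1 / 2) * (Acst * Real.exp (0 + 1) * K₀ 64 8 * 9 * 64) := by
          rw [show (5 : ℝ) * 0 + 1 = 0 + 1 by ring]; ring
      _ ≤ (1 / 2) * 1 := by gcongr
      _ ≤ 1 := by norm_num
  exact muPart_locE_le_of_coresAt_pencil_outerLabels_torus (GO N r hr)
    (Win := Set.univ) (ctr := ctr0) (ROp := fun _ => 1) (RHist := fun _ => 2) (R' := fun _ => 2)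
    (mq := fun _ _ _ => 1) (bq := fun _ _ _ => 0) (N₀ := fun _ _ _ => 1)
    hroom0 (fun _ _ _ _ _ _ _ => one_pos)
    (fun _ _ _ _ _ _ _ => ⟨fun _ _ => aestronglyMeasurable_const, fun _ => differentiableOn_const _, fun _ _ _ => by
      show ‖(1 : ℂ)‖ ≤ 1; rw [norm_one]⟩)
    (fun _ _ _ _ _ _ _ => ⟨fun _ _ => (Complex.measurable_ofReal.comp (measurable_snd.norm.pow_const 2)).aestronglyMeasurable,
      fun _ _ => differentiableOn_const _, fun _ _ _ v => by
        show 1 * ‖v‖ ^ 2 - 0 ≤ (((‖v‖ ^ 2 : ℝ) : ℂ)).re; rw [Complex.ofReal_re]; simp⟩)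
    (g := fun _ => 0) (Set.mem_univ _) (U := ()) (o := 0) (h₀ := 0) (v := liveTable) (μ₁ := μ₁)
    (by show ‖(0 : ℂ) - 0‖ ≤ 1; simp)
    (by show ‖(0 : B13HistM toyFrame) - 0‖ + μ₁ * ‖liveTable‖ ≤ 2; rw [sub_zero, norm_zero, zero_add];
        exact (mul_le_mul hμ₁ norm_liveTable_le (norm_nonneg _) (by norm_num)).trans (by norm_num))
    (emb := fun _ => k) (fun _ => rfl) (terms := termsO N) (act := actO N r hr k) (fun _ _ _ => rfl)
    (A := Acst / 2) (Rkp := 2 * (tgeometry 4 N).κ₀ + 2) (r₁ := 0) (X₀ N) (sμ := μ)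
    (by have := Acst_pos; positivity) le_rfl (DressedSmallFieldInnerLabelsWitness.hrate_Imu N) hsmall
    (fun _ => (Finset.univ : Finset Bool)) (nO N) (nO_nonneg N)
    (a := α₆F) (r := δF * κF) (R := RI N) (vW := vO N) α₆F_pos.le (vO_pos N).le hκ h229
    (hmember_Omu N) (hRR_Omu N) (hadm_Omu N) (hAmp_Omu N r hr hμ₁ k) h0 h01 hμ

open Classical in
/-- … in CLOSED FORM: the μ-part is `≤ (K₀(64,8)∕2)·μ₀∕(μ₁ − μ₀)`. [folklore] -/
theorem outerMuEnd_fires_closed {μ₁ μ₀ : ℝ} {μ : ℂ} (hμ₁ : μ₁ ≤ 2) (h0 : 0 < μ₀) (h01 : μ₀ < μ₁) (hμ : ‖μ‖ ≤ μ₀) (k : ℕ) :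
    ‖locE (TTouch (d := 4) (N := N)) (fun Z : (tsys 4 N).Dom => Z.1) (actO N r hr k μ) (X₀ N).1 -
        locE (TTouch (d := 4) (N := N)) (fun Z : (tsys 4 N).Dom => Z.1) (actO N r hr k 0) (X₀ N).1‖ ≤
      K₀ 64 8 / 2 * (μ₀ / (μ₁ - μ₀)) := by
  refine (outerMuEnd_fires N r hr hμ₁ h0 h01 hμ k).trans (le_of_eq ?_)
  rw [zero_mul, neg_zero, Real.exp_zero, mul_one]
  unfold Acst
  have hK := K₀_pos (64 : ℝ) 8
  have he := Real.exp_pos 1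
  field_simp

/-! ## §3 GENUINE: the μ-part of the activity at a REAL positive source is NOT zero -/

open Classical in
/-- **THE μ-PART AT A REAL POSITIVE SOURCE IS NOT ZERO** [decided toy]: `actO t X₀ − actO 0 X₀ = (Σ_l cO l)·∫ incr (t·r)` (W52's
`actO_real_sub_zero`) with positive total weight (W52's `sum_cO_X₀_pos`) and `∫ incr (t·r) > 0` for `0 < t`, `0 < r` (W33's
`integral_incr_pos`). [folklore] -/
theorem actO_mu_live (hr0 : 0 < r) {t : ℝ} (ht : 0 < t) (k : ℕ) : actO N r hr k (t : ℂ) (X₀ N) ≠ actO N r hr k 0 (X₀ N) := by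
  intro h
  have h0 := sub_eq_zero.2 h
  rw [actO_real_sub_zero] at h0
  rcases mul_eq_zero.1 h0 with hc | hI
  · exact (sum_cO_X₀_pos N r).ne' (by exact_mod_cast hc)
  · exact (integral_incr_pos (t * r) (mul_pos ht hr0)).ne' (by exact_mod_cast hI)

open Classical in
/-- **THE μ-END's BOUNDED QUANTITY IS NOT ZERO** for a REAL source `0 < t ≤ 2` [decided toy]: equal dressed outputs on the cube would
give equal activities at `X₀` (W24's `exp_locE_cube` BY NAME; W52's `norm_actO_X₀_lt_one` for `‖t‖ ≤ 2`), contradicting `actO_mu_live`.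
[folklore] -/
theorem outerMuEnd_live (hr0 : 0 < r) {t : ℝ} (ht : 0 < t) (ht2 : t ≤ 2) (k : ℕ) :
    locE (TTouch (d := 4) (N := N)) (fun Z : (tsys 4 N).Dom => Z.1) (actO N r hr k (t : ℂ)) (X₀ N).1 ≠
      locE (TTouch (d := 4) (N := N)) (fun Z : (tsys 4 N).Dom => Z.1) (actO N r hr k 0) (X₀ N).1 := by
  intro h
  have ht' : ‖(t : ℂ)‖ ≤ 2 := by rw [Complex.norm_real, Real.norm_eq_abs, abs_of_pos ht]; exact ht2
  have h1 := exp_locE_cube N (w := actO N r hr k (t : ℂ)) (norm_actO_X₀_lt_one N r hr k ht')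
  have h0 := exp_locE_cube N (w := actO N r hr k 0) (norm_actO_X₀_lt_one N r hr k (by simp))
  have h' : cexp (locE (TTouch (d := 4) (N := N)) (fun Z : (tsys 4 N).Dom => Z.1) (actO N r hr k (t : ℂ)) {0}) =
      cexp (locE (TTouch (d := 4) (N := N)) (fun Z : (tsys 4 N).Dom => Z.1) (actO N r hr k 0) {0}) := by
    rw [X₀_val] at h; exact congrArg cexp h
  rw [h1, h0, add_right_inj] at h'
  exact actO_mu_live N r hr hr0 ht k h'

/-- SANITY: W52 PART 2's table-strength liveness `actO_live` is the `t = 1` instance of the source-pencil liveness. -/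
example (hr0 : 0 < r) (k : ℕ) : actO N r hr k 1 (X₀ N) ≠ actO N r hr k 0 (X₀ N) := by
  simpa using actO_mu_live N r hr hr0 one_pos k

end Torus

end Summit.QuantumFields.BalabanUV.T4Continuum.NE1p.DressedSmallFieldOuterLabelsWitness

end
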